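import Summits.SmoothPoincare4.SmoothPoincare4.Theorems.ConvexBisectionAcyclicBisectionExistsPrimitiveOrbit
import Literature.Topology.FourManifolds.LefschetzBasePages
import Literature.Topology.FourManifolds.ClosedBallProofs
import HarnessLib

/-!
# Node N3a `node_STcurve` from its two geometric inputs: page Dehn twist packages along the
# generator classes, and one embedded page curve of class `chainVec g 0` (wave 6, brick G6-3 of
# stub `stub_STgeo` = NF4 N3, line `modp-braid-orbits`, crux `ConvexBisection.AcyclicBisectionExists`,
# item stmt-SmoothPoincare4-10508; registered sub-goal `helper_STcurve_of_twists`)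

The CORRECTED route to N3a (every primitive `v ∈ ℤ^{2g}` is the shadow of a smoothly embedded
curve in the flat open page `page g d`): by `…PrimitiveOrbit.lean` (`helper_primitive_transvection_orbit`)
`v` is reached from `chainVec g 0 = e_0` by finitely many signed transvections along GENERATOR
classes `a ∈ {chainVec g i | i < 2g} ∪ {e_j | j < g}` (the chain vectors alone do not suffice for
`g ≥ 2`, `…ChainOrbitParity.lean`).  Hence N3a follows (`stcurve_of_twists`, registered
`helper_STcurve_of_twists`) from

* (TWIST) for every generator class `a` and sign `s` a **page Dehn twist package**: a continuous
  self-map `τ` of `Base g` preserving `page g d`, carrying smoothly embedded page curves to smoothly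
  embedded curves, and acting on shadows of page loops by `transvection (stdSymp ℤ g) (a, s)` —
  to be supplied by node N1a (`shadow_pageDehnTwist_eq_transvection`, LANDED) applied to a
  page-preserving DIFFEOMORPHISM `τ` of `Base g` realising the Dehn twist in an annulus chart of a
  charted page curve of class `a` (`Manifold.IsSmoothEmbedding.diffeomorph_comp`; charted chain
  curves: `helper_exists_charted_chain`; the classes `e_j`, `j ≥ 1`, need new charted curves — the
  lifts of loops around the first `2j + 2` branch points);
* (BASE) one smoothly embedded curve in `page g d` with shadow `chainVec g 0`;

by induction along the orbit: the image of the current curve under the package of the next move.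
Everything is proved; no definitions, no named facts, no `sorry`.  Reference: B. Farb,
D. Margalit, *A primer on mapping class groups* (2012), Prop. 6.2, §6.1. [folklore]
-/

noncomputable section

set_option linter.dupNamespace false

open scoped Manifold ContDiff Topology
open Set Function
open Literature.Topology.FourManifolds Literature.Topology.FourManifolds.LefschetzBase
  Literature.GroupTheory.CombinatorialGroupTheory.SignedHurwitz

namespace Summit.SmoothPoincare4.SmoothPoincare4.Theorems.AcyclicBisectionExists.ModpBraidOrbits

/-- **N3a from twist packages and a base curve.**  If every generator class
`a ∈ {chainVec g i} ∪ {e_j}` (both signs) has a page Dehn twist package on `page g d`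
(continuous, page-preserving, embedding-preserving, acting on shadows by the signed transvection
along `a`), and some smoothly embedded curve of `page g d` has shadow `chainVec g 0`, then every
primitive class is the shadow of a smoothly embedded curve of `page g d`.
[cite: FarbMargalit2012, Prop. 6.2] -/
theorem stcurve_of_twists (g : ℕ) (d : ℂ)
    (htwist : ∀ (a : Fin g ⊕ Fin g → ℤ) (s : Bool),
      ((∃ i : ℕ, i < 2 * g ∧ a = chainVec g i) ∨ (∃ j : Fin g, a = Pi.single (Sum.inl j) 1)) →
      ∃ (τ : Base g → Base g) (hτ : Continuous τ), (∀ p ∈ page g d, τ p ∈ page g d) ∧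
        (∀ K : Metric.sphere (0 : EuclideanSpace ℝ (Fin 2)) 1 → Base g,
          Manifold.IsSmoothEmbedding (𝓡 1) (𝓡∂ 4) ∞ K → (∀ θ, K θ ∈ page g d) →
          Manifold.IsSmoothEmbedding (𝓡 1) (𝓡∂ 4) ∞ (τ ∘ K)) ∧
        (∀ (K : Metric.sphere (0 : EuclideanSpace ℝ (Fin 2)) 1 → Base g) (hK : Continuous K),
          (∀ θ, K θ ∈ page g d) →
          shadow g (τ ∘ K) (hτ.comp hK) = transvection (stdSymp ℤ g) (a, s) (shadow g K hK)))
    (hbase : ∃ K₀ : Metric.sphere (0 : EuclideanSpace ℝ (Fin 2)) 1 → Base g,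
      Manifold.IsSmoothEmbedding (𝓡 1) (𝓡∂ 4) ∞ K₀ ∧ (∀ θ, K₀ θ ∈ page g d) ∧
      ∃ hK₀ : Continuous K₀, shadow g K₀ hK₀ = chainVec g 0)
    (v : Fin g ⊕ Fin g → ℤ) (hv : IsPrimitive v) :
    ∃ K : Metric.sphere (0 : EuclideanSpace ℝ (Fin 2)) 1 → Base g,
      Manifold.IsSmoothEmbedding (𝓡 1) (𝓡∂ 4) ∞ K ∧ (∀ θ, K θ ∈ page g d) ∧
      ∃ hK : Continuous K, shadow g K hK = v := by
  have horb := orbit_chainVec_zero_of_isPrimitive g v hv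
  clear hv
  induction horb with
  | refl => exact hbase
  | tail _ hst ih =>
    obtain ⟨a, s, ha, rfl⟩ := hst
    obtain ⟨τ, hτ, hτp, hτe, hτs⟩ := htwist a s ha
    obtain ⟨K, hKe, hKp, hKc, hKs⟩ := ih
    exact ⟨τ ∘ K, hτe K hKe hKp, fun θ => hτp _ (hKp θ), hτ.comp hKc, by rw [hτs K hKc hKp, hKs]⟩

/-- **A twist package from a page-preserving diffeomorphism**: if `τ` is a diffeomorphism of
`Base g` preserving `page g d` and acting on shadows of page loops by the signed transvection
along `a`, it is a page Dehn twist package in the sense of `stcurve_of_twists` (embeddings go to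
embeddings by `Manifold.IsSmoothEmbedding.diffeomorph_comp`). [folklore] -/
theorem twistPackage_of_diffeomorph (g : ℕ) (d : ℂ) (a : Fin g ⊕ Fin g → ℤ) (s : Bool)
    (τ : Base g ≃ₘ^∞⟮𝓡∂ 4, 𝓡∂ 4⟯ Base g) (hτp : ∀ p ∈ page g d, τ p ∈ page g d)
    (hτs : ∀ (K : Metric.sphere (0 : EuclideanSpace ℝ (Fin 2)) 1 → Base g) (hK : Continuous K),
      (∀ θ, K θ ∈ page g d) →
      shadow g (τ ∘ K) (τ.continuous.comp hK) = transvection (stdSymp ℤ g) (a, s) (shadow g K hK)) :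
    ∃ (τ : Base g → Base g) (hτ : Continuous τ), (∀ p ∈ page g d, τ p ∈ page g d) ∧
      (∀ K : Metric.sphere (0 : EuclideanSpace ℝ (Fin 2)) 1 → Base g,
        Manifold.IsSmoothEmbedding (𝓡 1) (𝓡∂ 4) ∞ K → (∀ θ, K θ ∈ page g d) →
        Manifold.IsSmoothEmbedding (𝓡 1) (𝓡∂ 4) ∞ (τ ∘ K)) ∧
      (∀ (K : Metric.sphere (0 : EuclideanSpace ℝ (Fin 2)) 1 → Base g) (hK : Continuous K),
        (∀ θ, K θ ∈ page g d) →
        shadow g (τ ∘ K) (hτ.comp hK) = transvection (stdSymp ℤ g) (a, s) (shadow g K hK)) :=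
  ⟨τ, τ.continuous, hτp, fun _ hK _ => hK.diffeomorph_comp τ, hτs⟩

/-! ## The registered form -/

/-- **Sub-goal `helper_STcurve_of_twists`** (G6-3, node N3a `node_STcurve` from its geometric
inputs): page Dehn twist packages along the generator classes `chainVec g i` (`i < 2g`) and
`e_j = Pi.single (inl j) 1` (both signs) on `page g d`, plus one smoothly embedded curve of
`page g d` with shadow `chainVec g 0`, give a smoothly embedded curve of `page g d` in every
primitive class. [cite: FarbMargalit2012, Prop. 6.2] -/
theorem helper_STcurve_of_twists : ∀ (g : ℕ) (d : ℂ), (∀ (a : Fin g ⊕ Fin g → ℤ) (s : Bool), ((∃ i : ℕ, i < 2 * g ∧ a = Literature.Topology.FourManifolds.LefschetzBase.chainVec g i) ∨ (∃ j : Fin g, a = Pi.single (Sum.inl j) 1)) → ∃ (τ : Literature.Topology.FourManifolds.LefschetzBase.Base g → Literature.Topology.FourManifolds.LefschetzBase.Base g) (hτ : Continuous τ), (∀ p ∈ Literature.Topology.FourManifolds.LefschetzBase.page g d, τ p ∈ Literature.Topology.FourManifolds.LefschetzBase.page g d) ∧ (∀ K : Metric.sphere (0 : EuclideanSpace ℝ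 (Fin 2)) 1 → Literature.Topology.FourManifolds.LefschetzBase.Base g, Manifold.IsSmoothEmbedding (𝓡 1) (𝓡∂ 4) ∞ K → (∀ θ, K θ ∈ Literature.Topology.FourManifolds.LefschetzBase.page g d) → Manifold.IsSmoothEmbedding (𝓡 1) (𝓡∂ 4) ∞ (τ ∘ K)) ∧ (∀ (K : Metric.sphere (0 : EuclideanSpace ℝ (Fin 2)) 1 → Literature.Topology.FourManifolds.LefschetzBase.Base g) (hK : Continuous K), (∀ θ, K θ ∈ Literature.Topology.FourManifolds.LefschetzBase.page g d) → Literature.Topology.FourManifolds.LefschetzBase.shadow g (τ ∘ K) (hτ.comp hK) = Literature.GroupTheory.CombinatorialGroupTheory.SignedHurwitz.transvection (Literature.GroupTheory.CombinatorialGroupTheory.SignedHurwitz.stdSymp ℤ g) (a, s) (Literature.Topology.FourManifolds.LefschetzBase.shadow g K hK))) → (∃ K₀ : Metric.sphere (0 : EuclideanSpace ℝ (Fin 2)) 1 → Literature.Topology.FourManifolds.LefschetzBase.Base g, Manifold.IsSmoothEmbedding (𝓡 1) (𝓡∂ 4) ∞ K₀ ∧ (∀ θ, K₀ θ ∈ Literature.Topology.FourManifolds.LefschetzBase.page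 g d) ∧ ∃ hK₀ : Continuous K₀, Literature.Topology.FourManifolds.LefschetzBase.shadow g K₀ hK₀ = Literature.Topology.FourManifolds.LefschetzBase.chainVec g 0) → ∀ (v : Fin g ⊕ Fin g → ℤ), Literature.GroupTheory.CombinatorialGroupTheory.SignedHurwitz.IsPrimitive v → ∃ K : Metric.sphere (0 : EuclideanSpace ℝ (Fin 2)) 1 → Literature.Topology.FourManifolds.LefschetzBase.Base g, Manifold.IsSmoothEmbedding (𝓡 1) (𝓡∂ 4) ∞ K ∧ (∀ θ, K θ ∈ Literature.Topology.FourManifolds.LefschetzBase.page g d) ∧ ∃ hK : Continuous K, Literature.Topology.FourManifolds.LefschetzBase.shadow g K hK = v :=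
  fun g d htwist hbase v hv => stcurve_of_twists g d htwist hbase v hv

end Summit.SmoothPoincare4.SmoothPoincare4.Theorems.AcyclicBisectionExists.ModpBraidOrbits

end
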